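import Literature.MathematicalPhysics.QuantumFieldTheory.Balaban1983to89.BlockAveragingEMLProp2
import Literature.MathematicalPhysics.QuantumFieldTheory.Balaban1983to89.BlockAveragingEMLAnalyticMean
import Mathlib.Analysis.Calculus.MeanValue
import HarnessLib

/-!
# `FluctuationComparisonRegPrIntLOneBondFamily` — THE ONE-BOND EXP-MEAN-LOG FAMILY: `eml` is the arithmetic mean up to a `144 r`-Lipschitz
# remainder, and the one-bond family `i ↦ (p i ? 1 : V_i W*)` makes `E_V(W) := eml(family)` a `(m∕|ι| + 144 r)`-Lipschitz function of `W`

Cell `ym3-torus` (rung R3 = continuum `SU(2)` Yang–Mills on the three-torus — NOT d = 4, NOT infinite volume, NOT a mass gap, NOT Clay), width seat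
`ym-ust-20520-w5` (gen 21), pen (B1′) «Stage 1, part 1» named by LEAD-20520 w3 g22 (2026-08-30): the estimates behind the TOPOLOGICAL half of the per-bond
one-variable inverse law that `T4TriangularFibredChart` ∕ `…OrganTangentTriangularChart` (v2) display as hypotheses for Bałaban's block average
[Balaban1987RG1] (0.4) in its PRIVATE coordinate (`BlockAveragingEMLHaarAC.fibreMap`: with the environment frozen, the coarse bond variable is
`W ↦ E(V_i W⁻¹)·W`, `E = exp[mean log]`).  `--kind proof --supports stmt-QuantumFields-20520 --as helper`, count-neutral, definition-free, default heartbeats; THEOREMS ONLY (elementary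
estimates about the tree's own objects); nothing printed is asserted.  Sequel: `FluctuationComparisonRegPrIntLOneBondInverse` (injectivity, fixed-point inverse,
Lipschitz dependence on `SU(N)`).

## Content (the analytic input is `BlockAveragingEMLAnalyticMean`'s Cauchy-estimate constants `144`, `36`)

* §1 (any complete normed `ℂ`-algebra, any finite index type): **`norm_eml_sub_eml_sub_mean_le`** — on the family ball `‖U − 1‖ ≤ r ≤ 1∕24` the operation
  `eml = exp[mean log]` differs from the arithmetic mean by a `144 r`-LIPSCHITZ map: `‖eml U₁ − eml U₂ − mean(U₁ − U₂)‖ ≤ 144 r ‖U₁ − U₂‖` (mean-value inequality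
  for `eml − meanCLM`, whose derivative is `≤ 144‖U − 1‖` by `norm_fderiv_eml_sub_mean_le`); **`norm_eml_sub_eml_le`**.
* §2 (`M_N(ℂ)` with the `L²`-operator norm, `W, V_i` unitary): the ONE-BOND FAMILY `i ↦ (p i ? 1 : V_i W*)` (`p` = the central indices; the shape of
  `BlockAveragingEMLHaarAC.fibreFamily`) is `1`-Lipschitz in `W` (`norm_fam_sub_fam_le`), its MEAN is `(m∕|ι|)`-Lipschitz (`norm_mean_fam_sub_fam_le`, `m` = number of
  off-central indices), it lies in the family ball of radius `max_{¬p i} ‖V_i − W‖` (`norm_fam_sub_one_le`); hence `E_V(W) := eml(family)` is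
  **`(m∕|ι| + 144 r)`-LIPSCHITZ** (`norm_eml_fam_sub_le`) and `‖E_V(W) − 1‖ ≤ (m∕|ι|) r + 36 r²` (`norm_eml_fam_sub_one_le`).

Nothing about `descend`, towers, VER∘, O1, crux stmt-QuantumFields-20520 or `YM3TorusSU2` is proved here.  No `def`, `instance`, `notation`, `sorry`, `axiom`.
-/

noncomputable section

open Set Metric NormedSpace Function

namespace Summit.QuantumFields.YangMills.Theorems.FluctuationComparisonRegPrIntLOneBondFamily

open Literature.MathematicalPhysics.QuantumFieldTheory.Balaban1983to89

open B7TransferAnalyticMean (meanCLM meanCLM_apply norm_meanCLM_apply_le)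
open ExpMeanLog (eml deltaSU expMeanLogSU lt_third_of_lt_deltaSU)
open BlockAveragingEMLAnalyticMean (isAnalyticMean_eml norm_fderiv_eml_sub_mean_le norm_eml_add_sub_eml_le norm_eml_one_add_sub_sub_mean_le)

/-! ## §1 `eml` is the arithmetic mean up to a `144 r`-Lipschitz remainder on the family ball -/

section Generic

variable {ι : Type*} [Fintype ι] {𝔄 : Type*} [NormedRing 𝔄] [NormedAlgebra ℂ 𝔄] [CompleteSpace 𝔄]

/-- `eml` is differentiable at every family within `1∕3` of the identity family. [folklore] -/
theorem differentiableAt_eml {U : ι → 𝔄} (hU : ‖U - 1‖ < 1 / 3) : DifferentiableAt ℂ (eml : (ι → 𝔄) → 𝔄) U :=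
  ((isAnalyticMean_eml (ι := ι) (𝔸 := 𝔄)).analyticOnNhd U (by rwa [mem_ball, dist_eq_norm])).differentiableAt

/-- The operator-norm form of `C′_M = 144`: `‖D eml(U) − mean‖ ≤ 144 ‖U − 1‖` for `‖U − 1‖ ≤ 1∕24`. [folklore] -/
theorem opNorm_fderiv_eml_sub_mean_le {U : ι → 𝔄} (hU : ‖U - 1‖ ≤ 1 / 24) :
    ‖fderiv ℂ (eml : (ι → 𝔄) → 𝔄) U - meanCLM ι 𝔄‖ ≤ 144 * ‖U - 1‖ := by
  refine ContinuousLinearMap.opNorm_le_bound _ (by positivity) fun W => ?_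
  calc ‖(fderiv ℂ (eml : (ι → 𝔄) → 𝔄) U - meanCLM ι 𝔄) W‖ = ‖fderiv ℂ (eml : (ι → 𝔄) → 𝔄) U W - meanCLM ι 𝔄 W‖ := rfl
    _ ≤ 144 * ‖W‖ * ‖U - 1‖ := norm_fderiv_eml_sub_mean_le hU W
    _ = 144 * ‖U - 1‖ * ‖W‖ := by ring

/-- **`eml` MINUS THE MEAN IS `144 r`-LIPSCHITZ ON THE FAMILY BALL `‖U − 1‖ ≤ r ≤ 1∕24`** (mean-value inequality on the convex ball for
`U ↦ eml U − mean U`). [folklore] -/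
theorem norm_eml_sub_eml_sub_mean_le {r : ℝ} (hr : r ≤ 1 / 24) {U₁ U₂ : ι → 𝔄} (h₁ : ‖U₁ - 1‖ ≤ r) (h₂ : ‖U₂ - 1‖ ≤ r) :
    ‖eml U₁ - eml U₂ - meanCLM ι 𝔄 (U₁ - U₂)‖ ≤ 144 * r * ‖U₁ - U₂‖ := by
  have hball : ∀ U ∈ closedBall (1 : ι → 𝔄) r, ‖U - 1‖ ≤ r := fun U hU => by rwa [mem_closedBall, dist_eq_norm] at hU
  have hdiff : ∀ U ∈ closedBall (1 : ι → 𝔄) r, DifferentiableAt ℂ (fun U => eml U - meanCLM ι 𝔄 U) U := fun U hU =>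
    (differentiableAt_eml (by linarith [hball U hU])).sub (meanCLM ι 𝔄).differentiableAt
  have hbound : ∀ U ∈ closedBall (1 : ι → 𝔄) r, ‖fderiv ℂ (fun U => eml U - meanCLM ι 𝔄 U) U‖ ≤ 144 * r := by
    intro U hU
    have hU' : ‖U - 1‖ ≤ 1 / 24 := (hball U hU).trans hr
    rw [fderiv_fun_sub (differentiableAt_eml (by linarith [hball U hU])) (meanCLM ι 𝔄).differentiableAt, ContinuousLinearMap.fderiv]
    calc _ ≤ 144 * ‖U - 1‖ := opNorm_fderiv_eml_sub_mean_le hU'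
      _ ≤ 144 * r := by nlinarith [hball U hU]
  have h := (convex_closedBall (1 : ι → 𝔄) r).norm_image_sub_le_of_norm_fderiv_le hdiff hbound
    (by rw [mem_closedBall, dist_eq_norm]; exact h₂) (by rw [mem_closedBall, dist_eq_norm]; exact h₁)
  have e : eml U₁ - meanCLM ι 𝔄 U₁ - (eml U₂ - meanCLM ι 𝔄 U₂) = eml U₁ - eml U₂ - meanCLM ι 𝔄 (U₁ - U₂) := by
    rw [map_sub]; abel
  rw [← e]; exact h

/-- **`eml` IS `(‖mean‖ + 144 r)`-LIPSCHITZ ON THE FAMILY BALL**: `‖eml U₁ − eml U₂‖ ≤ ‖mean(U₁ − U₂)‖ + 144 r ‖U₁ − U₂‖`. [folklore] -/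
theorem norm_eml_sub_eml_le {r : ℝ} (hr : r ≤ 1 / 24) {U₁ U₂ : ι → 𝔄} (h₁ : ‖U₁ - 1‖ ≤ r) (h₂ : ‖U₂ - 1‖ ≤ r) :
    ‖eml U₁ - eml U₂‖ ≤ ‖meanCLM ι 𝔄 (U₁ - U₂)‖ + 144 * r * ‖U₁ - U₂‖ := by
  have h := norm_eml_sub_eml_sub_mean_le hr h₁ h₂
  have e : eml U₁ - eml U₂ = meanCLM ι 𝔄 (U₁ - U₂) + (eml U₁ - eml U₂ - meanCLM ι 𝔄 (U₁ - U₂)) := by abel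
  rw [e]
  exact (norm_add_le _ _).trans (by linarith)

end Generic

/-! ## §2 The one-bond family in the matrix model: Lipschitz and size estimates -/

section Family

open scoped Matrix.Norms.L2Operator

variable {n : Type*} [Fintype n] [DecidableEq n] {ι : Type*} [Fintype ι]

/-- Right multiplication by the adjoint of a unitary is an isometry: `‖X·W*‖ = ‖X‖`. [folklore] -/
theorem norm_mul_star_of_mem_unitary (X : Matrix n n ℂ) {W : Matrix n n ℂ} (hW : W ∈ Matrix.unitaryGroup n ℂ) :
    ‖X * star W‖ = ‖X‖ :=
  CStarRing.norm_mul_mem_unitary X (Unitary.star_mem hW)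

/-- Left multiplication by a unitary is an isometry: `‖V·X‖ = ‖X‖`. [folklore] -/
theorem norm_unitary_mul (X : Matrix n n ℂ) {V : Matrix n n ℂ} (hV : V ∈ Matrix.unitaryGroup n ℂ) :
    ‖V * X‖ = ‖X‖ :=
  CStarRing.norm_mem_unitary_mul X hV

/-- `‖V W* − 1‖ = ‖V − W‖` for unitary `W`. [folklore] -/
theorem norm_mul_star_sub_one (V : Matrix n n ℂ) {W : Matrix n n ℂ} (hW : W ∈ Matrix.unitaryGroup n ℂ) :
    ‖V * star W - 1‖ = ‖V - W‖ := by
  have e : V * star W - 1 = (V - W) * star W := by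
    rw [sub_mul, Unitary.mul_star_self_of_mem hW]
  rw [e, norm_mul_star_of_mem_unitary _ hW]

/-- **THE ONE-BOND FAMILY LIES IN THE FAMILY BALL of radius `max_{¬p i} ‖V_i − W‖`**: if `‖V_i − W‖ ≤ r` at every off-central index then the family
`i ↦ (p i ? 1 : V_i W*)` is within `r` of the identity family. [cite: Balaban1987RG1, (0.4) p.253 (bookkeeping)] -/
theorem norm_fam_sub_one_le (p : ι → Prop) [DecidablePred p] (V : ι → Matrix n n ℂ) {W : Matrix n n ℂ}
    (hW : W ∈ Matrix.unitaryGroup n ℂ) {r : ℝ} (hr : 0 ≤ r) (h : ∀ i, ¬ p i → ‖V i - W‖ ≤ r) :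
    ‖(fun i => if p i then (1 : Matrix n n ℂ) else V i * star W) - 1‖ ≤ r := by
  refine (pi_norm_le_iff_of_nonneg hr).2 fun i => ?_
  simp only [Pi.sub_apply, Pi.one_apply]
  split_ifs with hi
  · rw [sub_self, norm_zero]; exact hr
  · rw [norm_mul_star_sub_one _ hW]; exact h i hi

/-- **THE FAMILY IS `1`-LIPSCHITZ IN `W`** (off-central entries `V_i(W₁* − W₂*)`, central ones cancel). [folklore] -/
theorem norm_fam_sub_fam_le (p : ι → Prop) [DecidablePred p] {V : ι → Matrix n n ℂ} (hV : ∀ i, ¬ p i → V i ∈ Matrix.unitaryGroup n ℂ)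
    (W₁ W₂ : Matrix n n ℂ) :
    ‖(fun i => if p i then (1 : Matrix n n ℂ) else V i * star W₁) - (fun i => if p i then (1 : Matrix n n ℂ) else V i * star W₂)‖ ≤ ‖W₁ - W₂‖ := by
  refine (pi_norm_le_iff_of_nonneg (norm_nonneg _)).2 fun i => ?_
  simp only [Pi.sub_apply]
  split_ifs with hi
  · rw [sub_self, norm_zero]; exact norm_nonneg _
  · rw [← mul_sub, norm_unitary_mul _ (hV i hi), ← star_sub, norm_star]

/-- **THE MEAN OF THE FAMILY DIFFERENCE IS `(m∕|ι|)`-LIPSCHITZ**, `m` = number of off-central indices (only they move). [folklore] -/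
theorem norm_mean_fam_sub_fam_le (p : ι → Prop) [DecidablePred p] {V : ι → Matrix n n ℂ}
    (hV : ∀ i, ¬ p i → V i ∈ Matrix.unitaryGroup n ℂ) (W₁ W₂ : Matrix n n ℂ) :
    ‖meanCLM ι (Matrix n n ℂ) ((fun i => if p i then (1 : Matrix n n ℂ) else V i * star W₁) -
        (fun i => if p i then (1 : Matrix n n ℂ) else V i * star W₂))‖ ≤
      ((Finset.univ.filter fun i => ¬ p i).card : ℝ) / (Fintype.card ι : ℝ) * ‖W₁ - W₂‖ := by
  rw [meanCLM_apply]
  have hsum : (∑ j, ((fun i => if p i then (1 : Matrix n n ℂ) else V i * star W₁) -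
        (fun i => if p i then (1 : Matrix n n ℂ) else V i * star W₂)) j) =
      ∑ j ∈ Finset.univ.filter (fun i => ¬ p i), V j * star (W₁ - W₂) := by
    rw [Finset.sum_filter]
    refine Finset.sum_congr rfl fun j _ => ?_
    simp only [Pi.sub_apply]
    split_ifs with hj
    · exact sub_self _
    · rw [star_sub, mul_sub]
  rw [hsum, norm_smul, norm_inv, Complex.norm_natCast]
  have hterm : ∀ j ∈ Finset.univ.filter (fun i => ¬ p i), ‖V j * star (W₁ - W₂)‖ ≤ ‖W₁ - W₂‖ := by
    intro j hj
    rw [Finset.mem_filter] at hj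
    rw [norm_unitary_mul _ (hV j hj.2), norm_star]
  calc (Fintype.card ι : ℝ)⁻¹ * ‖∑ j ∈ Finset.univ.filter (fun i => ¬ p i), V j * star (W₁ - W₂)‖
      ≤ (Fintype.card ι : ℝ)⁻¹ * ∑ j ∈ Finset.univ.filter (fun i => ¬ p i), ‖W₁ - W₂‖ :=
        mul_le_mul_of_nonneg_left ((norm_sum_le _ _).trans (Finset.sum_le_sum hterm)) (by positivity)
    _ = ((Finset.univ.filter fun i => ¬ p i).card : ℝ) / (Fintype.card ι : ℝ) * ‖W₁ - W₂‖ := by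
        rw [Finset.sum_const, nsmul_eq_mul]; ring

/-- **THE MEAN OF `family − 1` IS AT MOST `(m∕|ι|)·r`** on the family ball. [folklore] -/
theorem norm_mean_fam_sub_one_le (p : ι → Prop) [DecidablePred p] (V : ι → Matrix n n ℂ) {W : Matrix n n ℂ}
    (hW : W ∈ Matrix.unitaryGroup n ℂ) {r : ℝ} (h : ∀ i, ¬ p i → ‖V i - W‖ ≤ r) :
    ‖meanCLM ι (Matrix n n ℂ) ((fun i => if p i then (1 : Matrix n n ℂ) else V i * star W) - 1)‖ ≤
      ((Finset.univ.filter fun i => ¬ p i).card : ℝ) / (Fintype.card ι : ℝ) * r := by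
  rw [meanCLM_apply]
  have hsum : (∑ j, ((fun i => if p i then (1 : Matrix n n ℂ) else V i * star W) - 1) j) =
      ∑ j ∈ Finset.univ.filter (fun i => ¬ p i), (V j * star W - 1) := by
    rw [Finset.sum_filter]
    refine Finset.sum_congr rfl fun j _ => ?_
    simp only [Pi.sub_apply, Pi.one_apply]
    split_ifs with hj
    · exact sub_self _
    · rfl
  rw [hsum, norm_smul, norm_inv, Complex.norm_natCast]
  have hterm : ∀ j ∈ Finset.univ.filter (fun i => ¬ p i), ‖V j * star W - 1‖ ≤ r := by
    intro j hj
    rw [Finset.mem_filter] at hj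
    rw [norm_mul_star_sub_one _ hW]; exact h j hj.2
  calc (Fintype.card ι : ℝ)⁻¹ * ‖∑ j ∈ Finset.univ.filter (fun i => ¬ p i), (V j * star W - 1)‖
      ≤ (Fintype.card ι : ℝ)⁻¹ * ∑ j ∈ Finset.univ.filter (fun i => ¬ p i), r :=
        mul_le_mul_of_nonneg_left ((norm_sum_le _ _).trans (Finset.sum_le_sum hterm)) (by positivity)
    _ = ((Finset.univ.filter fun i => ¬ p i).card : ℝ) / (Fintype.card ι : ℝ) * r := by
        rw [Finset.sum_const, nsmul_eq_mul]; ring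

/-- **`E_V(W) := eml(family)` IS `(m∕|ι| + 144 r)`-LIPSCHITZ IN `W`** on `{W : ∀ ¬p i, ‖V_i − W‖ ≤ r}`, `r ≤ 1∕24` (§1 + the two family estimates).
[cite: Balaban1987RG1, (0.4)/(0.8) p.253] -/
theorem norm_eml_fam_sub_le (p : ι → Prop) [DecidablePred p] {V : ι → Matrix n n ℂ}
    (hV : ∀ i, ¬ p i → V i ∈ Matrix.unitaryGroup n ℂ) {r : ℝ} (hr0 : 0 ≤ r) (hr : r ≤ 1 / 24)
    {W₁ W₂ : Matrix n n ℂ} (hW₁ : W₁ ∈ Matrix.unitaryGroup n ℂ) (hW₂ : W₂ ∈ Matrix.unitaryGroup n ℂ)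
    (h₁ : ∀ i, ¬ p i → ‖V i - W₁‖ ≤ r) (h₂ : ∀ i, ¬ p i → ‖V i - W₂‖ ≤ r) :
    ‖eml (fun i => if p i then (1 : Matrix n n ℂ) else V i * star W₁) - eml (fun i => if p i then (1 : Matrix n n ℂ) else V i * star W₂)‖ ≤
      (((Finset.univ.filter fun i => ¬ p i).card : ℝ) / (Fintype.card ι : ℝ) + 144 * r) * ‖W₁ - W₂‖ := by
  have hA := norm_eml_sub_eml_le hr (norm_fam_sub_one_le p V hW₁ hr0 h₁) (norm_fam_sub_one_le p V hW₂ hr0 h₂)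
  have hB := norm_mean_fam_sub_fam_le p hV W₁ W₂
  have hC := norm_fam_sub_fam_le p hV W₁ W₂
  have h144 : 0 ≤ 144 * r := by positivity
  calc _ ≤ _ := hA
    _ ≤ ((Finset.univ.filter fun i => ¬ p i).card : ℝ) / (Fintype.card ι : ℝ) * ‖W₁ - W₂‖ + 144 * r * ‖W₁ - W₂‖ :=
        add_le_add hB (mul_le_mul_of_nonneg_left hC h144)
    _ = _ := by ring

/-- **`‖E_V(W) − 1‖ ≤ (m∕|ι|)·r + 36 r²`** on the family ball (`r ≤ 1∕12`): first order is the mean, second order is `36‖·‖²`. [cite: Balaban1987RG1, (0.8) p.253] -/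
theorem norm_eml_fam_sub_one_le (p : ι → Prop) [DecidablePred p] (V : ι → Matrix n n ℂ) {W : Matrix n n ℂ}
    (hW : W ∈ Matrix.unitaryGroup n ℂ) {r : ℝ} (hr0 : 0 ≤ r) (hr : r ≤ 1 / 12) (h : ∀ i, ¬ p i → ‖V i - W‖ ≤ r) :
    ‖eml (fun i => if p i then (1 : Matrix n n ℂ) else V i * star W) - 1‖ ≤
      ((Finset.univ.filter fun i => ¬ p i).card : ℝ) / (Fintype.card ι : ℝ) * r + 36 * r ^ 2 := by
  set f : ι → Matrix n n ℂ := fun i => if p i then (1 : Matrix n n ℂ) else V i * star W with hf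
  have hf1 : ‖f - 1‖ ≤ r := norm_fam_sub_one_le p V hW hr0 h
  have h2 := norm_eml_one_add_sub_sub_mean_le (ι := ι) (𝔸 := Matrix n n ℂ) (V := f - 1) (hf1.trans hr)
  rw [add_sub_cancel] at h2
  have hm := norm_mean_fam_sub_one_le p V hW h
  have e : eml f - 1 = meanCLM ι (Matrix n n ℂ) (f - 1) + (eml f - 1 - meanCLM ι (Matrix n n ℂ) (f - 1)) := by abel
  rw [e]
  refine (norm_add_le _ _).trans (add_le_add hm (h2.trans ?_))
  nlinarith [norm_nonneg (f - 1)]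

end Family

end Summit.QuantumFields.YangMills.Theorems.FluctuationComparisonRegPrIntLOneBondFamily
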